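import Summits.BirchSwinnertonDyer.Rank1Residual.GaloisImage.KolyvaginLevelOneNineDividesOfBaseRigidity
import Summits.BirchSwinnertonDyer.Rank1Residual.GaloisImage.PrimeChoiceSakamotoDeep
import Summits.BirchSwinnertonDyer.Rank1Residual.GaloisImage.PrimeChoiceSakamotoTorsion
import Summits.BirchSwinnertonDyer.Rank1Residual.GaloisImage.CanonicalKolyvaginDatumAdmissibleDeep
import Summits.BirchSwinnertonDyer.Rank1Residual.GaloisImage.IrreducibleModThreeH3Tower
import Summits.BirchSwinnertonDyer.Rank1Residual.GaloisImage.KolyvaginDeepDatum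
import Summits.BirchSwinnertonDyer.Rank1Residual.GaloisImage.PropagatedStructureUnramified
import HarnessLib

/-!
# Base rigidity for `E[3]` on a DEEP-class Kolyvagin datum: the injectivity input `hinj` of
# END-m2 / END-m1 DISCHARGED, no [S24] binder, no tower
# (cell `b2b-bsdres`, team n1011, seat p15 GEN 4, OWNERS row T-INJ-DEV file F-E1; ROUTE-1 R1-58 ×
# §33.3; skeleton `cells/n1011/skel/T-INJ-DEV.md`; file name as announced by n1011-p09 17:47Z so that
# the consumers' import line is the announced one)

HONEST FRAMING (cell `b2b-bsdres`, run/shared/lean/b2b/bsd-rank1-residual/, verbatim in every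
file): the goal of the cell is to DELETE the COMBINATION-SHAPED residual classes of the
Birch–Swinnerton-Dyer formula for ALL analytic-rank `≤ 1` elliptic curves over `ℚ` — "full BSD
formula for every rank `≤ 1` curve in class `C`" assembled STRICTLY from published theorems — so
that the rank-`≤ 1` remainder becomes exactly the CONSTRUCTION-SHAPED classes, which are TYPED
(missing-input `Prop`s), NOT attempted. This is not "finishing BSD". Team n1011 (N10 / N11, the
additive block X4 ∧ `p = 3`): research route on the CONSTRUCTION-SHAPED class X4; prove what is
provable now; no claim beyond stated classes; nothing is booked; no label and no RESIDUAL-MAP mark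
is moved. TOOL theorems for END-m2 (n1011-p15 F-D `KolyvaginLevelTwoNineDivides`) and END-m1
(n1011-p09): their hypothesis `hinj` — injectivity of Kolyvagin-system evaluation at `∅` on the
`E[3]`-datum whose primes are a DEEP Frobenius class — becomes a THEOREM of `ρ̄_{E,3}` onto (in fact of
`E[3]` irreducible for (H.3), cc-typer-1's `hH3_three_pow_of_irr`) modulo the Poitou–Tate family and
`hEP`, exactly as R1-58. Theorems only: no definition, no named fact, no `sorry`.

## What

* §1 `PrimeChoice.hC55_deep_of_hasSurjectiveModNGaloisRep` — Sakamoto's Cor. 5.5 for three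
  classes of `H¹(ℚ, E[p])` on a DEEP class `frobeniusClassPrimes ρ′ S τ N′` (n1011-p15 F-C
  `_three_deep`; (H.1) from `ρ̄_{E,p}` onto; (H.3) on the deep group a hypothesis).
* §2 `CoreRankOne.torsion_apply_eq_zero_of_apply_empty_eq_zero_rat_deep` — n1011-p11's R1-58
  `apply_eq_zero_of_apply_empty_eq_zero` for `E[p]` over `ℚ` on a Kolyvagin datum whose primes ARE a
  deep class (n1011-p09's `…_rat` one class up: local package per prime through
  `S24Deep.frobeniusClassPrimes_mono`, mixed pair from §1 through the inverse Weil map).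
* §3 **`kolyvaginSystem_eq_zero_of_apply_empty_eq_zero_of_baseRigidity_deep`** — the N11 reading on
  `(E[3], 𝓕̄_can)` with primes `frobeniusClassPrimes (E[3^{k′}·3]) {v | inr v ∈ S} τ 3^{k′+1}`:
  LITERALLY the `hinj` of END-m2 / END-m1 for such data; (H.3) on the deep group from `Irr W 3`
  (`hH3_three_pow_of_irr`), admissibility of THE canonical comparison maps
  (`FSComp.isAdmissible_of_hasCanonicalComparison_of_subset`), `#H¹_{𝓕̄_can} = 3` from the core
  vertex hypothesis and core rank one (`hEP`).

References: K. Rubin, PCMI 18 (2011) Prop. 2.3.2, Cor. 2.8.9 [Rubin2011]; R. Sakamoto, JTNB 36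
(2024) Cor. 5.5 [Sakamoto2024]; B. Mazur, K. Rubin, Mem. AMS 799 (2004) Prop. 3.6.1, Lemma 3.5.2,
§3.5 (H.5) [MazurRubin2004]; J.-P. Serre, Invent. Math. 15 (1972) §2.4 Prop. 15.
-/

noncomputable section

open scoped Classical NumberField ContRepresentation
open Function Field NumberField IsDedekindDomain
open WeierstrassCurve Literature.NumberTheory.EllipticCurves Literature.NumberTheory.EllipticCurves.Rank1Residual
  Literature.NumberTheory.GaloisRepresentations
  Literature.NumberTheory.GaloisRepresentations.DiscreteGaloisModule Literature.NumberTheory.GaloisCohomology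

namespace Summit.BirchSwinnertonDyer.Rank1Residual.GaloisImage

open Summit.BirchSwinnertonDyer.Rank1Residual.X11b.LocBridge
open Summit.BirchSwinnertonDyer.Rank1Residual.GaloisImage.CoreRankZero

/-! ### §1 Cor. 5.5 for `E[p]` on a deep class -/

/-- **Sakamoto Cor. 5.5 for three classes of `H¹(ℚ, E[p])` on a DEEP Frobenius class**
`frobeniusClassPrimes ρ′ S τ N′` (`ρ′` an auxiliary finite module with `ker ρ′ ≤ ker ρ_{E[p]}`, e.g.
`E[p^{m}]`): (H.1) from `ρ̄_{E,p}` onto (`p` odd), (H.2) `E[p]/(τ − 1) ≅ ℤ/p`, (H.3) on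
`G_F′ = ker ρ′ ⊓ Gal(ℚ̄/ℚ(μ_{N′}))` a HYPOTHESIS (for `E`, `p = 3`: `hH3_three_pow_of_irr`); F-C.
[cite: Sakamoto2024, Cor. 5.5 (p. 929)] [cite: MazurRubin2004, Prop. 3.6.1 (pp. 30–31)] -/
theorem PrimeChoice.hC55_deep_of_hasSurjectiveModNGaloisRep (W : WeierstrassCurve ℚ) [W.IsElliptic]
    (p : ℕ) [Fact p.Prime] (hp2 : p ≠ 2) (hsurj : W.HasSurjectiveModNGaloisRep (p : ℤ))
    {M' : Type} [AddCommGroup M'] [TopologicalSpace M'] [DiscreteTopology M'] [Finite M']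
    (ρ' : DiscreteGaloisModule ℚ M')
    (hker : ∀ u : absoluteGaloisGroup ℚ, ρ' u = 1 → W.torsionGaloisModule (p : ℤ) u = 1)
    {N' : ℕ} (hN' : N' ≠ 0) (S : Set (HeightOneSpectrum (𝓞 ℚ))) (hS : S.Finite)
    {τ : absoluteGaloisGroup ℚ} (hτ : Nonempty (cokerSubOne (W.torsionGaloisModule (p : ℤ)) τ ≃+ ZMod p))
    (hH3 : ∀ f : contOneCocycles (W.torsionGaloisModule (p : ℤ)).toTopRep,
      (∀ u : absoluteGaloisGroup ℚ, ρ' u = 1 → u ∈ rootsOfUnityFixer ℚ N' → f.1 u = 0) →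
        oneCocycleClass (W.torsionGaloisModule (p : ℤ)).toTopRep f = 0) :
    ∀ c₁ c₂ c₃ : galoisCohomology (W.torsionGaloisModule (p : ℤ)) 1, c₁ ≠ 0 → c₂ ≠ 0 → c₃ ≠ 0 →
      {q ∈ frobeniusClassPrimes ρ' S τ N' |
        galoisCohomology.localization (W.torsionGaloisModule (p : ℤ)) (Sum.inr q) 1 c₁ ≠ 0 ∧
        galoisCohomology.localization (W.torsionGaloisModule (p : ℤ)) (Sum.inr q) 1 c₂ ≠ 0 ∧
        galoisCohomology.localization (W.torsionGaloisModule (p : ℤ)) (Sum.inr q) 1 c₃ ≠ 0}.Infinite := by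
  have hp : p.Prime := Fact.out
  haveI : NeZero (p : ℚ) := ⟨Nat.cast_ne_zero.mpr hp.ne_zero⟩
  haveI : Finite (geomTorsion W (p : ℤ)) :=
    finite_torsionPoints_holds W (AlgebraicClosure ℚ) (by exact_mod_cast hp.ne_zero)
  have hp3 : 3 ≤ p := by
    rcases hp.eq_two_or_odd' with h | h
    · exact absurd h hp2
    · have := hp.two_le; omega
  have hirr := hasIrreducibleModPGaloisRep_of_hasSurjectiveModNGaloisRep W p hsurj
  exact PrimeChoice.infinite_setOf_mem_frobeniusClassPrimes_localization_ne_zero_three_deep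
    (W.torsionGaloisModule (p : ℤ)) ρ' hker hp3 hN' S hS hτ
    (fun A hA => hirr A fun σ P hP => hA σ P hP) hH3

/-! ### §2 Base rigidity for `E[p]` over `ℚ` on a deep-class datum -/

namespace CoreRankOne

/-- **Base rigidity for `E[p]` over `ℚ` on a DEEP-class Kolyvagin datum** (n1011-p11's R1-58
`apply_eq_zero_of_apply_empty_eq_zero`, instantiated as n1011-p09's `…_rat` but with
`D.primes = frobeniusClassPrimes ρ′ {v | inr v ∈ S} τ N′`, `p ∣ N′`, `ker ρ′ ≤ ker ρ_{E[p]}`): `𝓕` any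
structure on `E[p]` unramified outside `S` with `#H¹_𝓕 = p` and `H¹_{𝓕^*} = 0`, the local package at
the primes from the level-`p` class through `S24Deep.frobeniusClassPrimes_mono` (Rubin Prop. 1.4.13 /
1.9.5 shapes, n1011-p18), the mixed pair from §1 through the inverse Weil map.  THEN every Kolyvagin
system with `κ_∅ = 0` vanishes at every level. [cite: Rubin2011, Prop. 2.3.2 (1) and Cor. 2.8.9 (2) (pp. 19, 25)]
[cite: Sakamoto2024, Cor. 5.5 (p. 929)] [cite: SilvermanAEC2009, Prop. III.8.1] -/
theorem torsion_apply_eq_zero_of_apply_empty_eq_zero_rat_deep (W : WeierstrassCurve ℚ) [W.IsElliptic]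
    (p : ℕ) [Fact p.Prime] (hp2 : p ≠ 2) [Finite (geomTorsion W (p : ℤ))]
    (hsurj : W.HasSurjectiveModNGaloisRep (p : ℤ))
    {M' : Type} [AddCommGroup M'] [TopologicalSpace M'] [DiscreteTopology M'] [Finite M']
    (ρ' : DiscreteGaloisModule ℚ M')
    (hker : ∀ u : absoluteGaloisGroup ℚ, ρ' u = 1 → W.torsionGaloisModule (p : ℤ) u = 1)
    {N' : ℕ} (hN' : N' ≠ 0) (hpN' : p ∣ N')
    {inv : LocalInvariants ℚ p}
    (hperf : inv.IsPerfect) (hsum : inv.SumLocalTermEqZero) (hcompl : inv.SelmerComplement)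
    {S : Finset (Place ℚ)}
    (hS : ∀ v : HeightOneSpectrum (𝓞 ℚ), (Sum.inr v : Place ℚ) ∉ S →
      ((p : ℕ) : 𝓞 ℚ) ∉ v.asIdeal ∧ GaloisRep.IsUnramifiedAt v (W.torsionGaloisModule (p : ℤ)))
    {𝓕 : SelmerStructure (W.torsionGaloisModule (p : ℤ))} (h𝓕 : 𝓕.IsUnramifiedOutside S)
    (h1 : Nat.card 𝓕.selmerGroup = p)
    (h0 : (inv.dualSelmerStructure (W.torsionGaloisModule (p : ℤ)) 𝓕).selmerGroup = ⊥)
    {D : KolyvaginDatum (W.torsionGaloisModule (p : ℤ))} {τ : absoluteGaloisGroup ℚ}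
    (hP : D.primes = frobeniusClassPrimes ρ' {v | (Sum.inr v : Place ℚ) ∈ S} τ N')
    (hT : D.transverse = cyclotomicTransverse (W.torsionGaloisModule (p : ℤ)))
    (hτ : Nonempty (cokerSubOne (W.torsionGaloisModule (p : ℤ)) τ ≃+ ZMod p))
    (hτμ : τ ∈ rootsOfUnityFixer ℚ N')
    (hH3 : ∀ f : contOneCocycles (W.torsionGaloisModule (p : ℤ)).toTopRep,
      (∀ u : absoluteGaloisGroup ℚ, ρ' u = 1 → u ∈ rootsOfUnityFixer ℚ N' → f.1 u = 0) →
        oneCocycleClass (W.torsionGaloisModule (p : ℤ)).toTopRep f = 0)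
    (hadm : D.IsAdmissible)
    {κ : Finset (HeightOneSpectrum (𝓞 ℚ)) → galoisCohomology (W.torsionGaloisModule (p : ℤ)) 1}
    (hκ : D.IsKolyvaginSystem 𝓕 κ) (hκ₀ : κ ∅ = 0) (n : Finset (HeightOneSpectrum (𝓞 ℚ))) :
    κ n = 0 := by
  have hp : p.Prime := Fact.out
  haveI : NeZero p := ⟨hp.ne_zero⟩
  obtain ⟨e, hμ, hadd₁, hadd₂, -, hnondeg, hgal⟩ :=
    exists_weilPairing_holds W p hp.two_le (Nat.cast_ne_zero.2 hp.ne_zero)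
  have hM : ∀ m : geomTorsion W (p : ℤ), p • m = 0 := fun T => AddSubgroup.torsionBy.nsmul T
  have hτμp : τ ∈ rootsOfUnityFixer ℚ p := rootsOfUnityFixer_le_of_dvd ℚ hpN' hτμ
  -- the primes of the datum lie in the level-`p` class of `E[p]` and outside `S`
  have hmono : ∀ q ∈ D.primes, q ∈ frobeniusClassPrimes (W.torsionGaloisModule (p : ℤ))
      {v | (Sum.inr v : Place ℚ) ∈ S} τ p := fun q hq =>
    S24Deep.frobeniusClassPrimes_mono (W.torsionGaloisModule (p : ℤ)) ρ' hker _ τ hpN' (hP ▸ hq)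
  have hPS : ∀ q ∈ D.primes, (Sum.inr q : Place ℚ) ∉ S := fun q hq => (hmono q hq).1
  -- the local shape at the Kolyvagin primes
  have hprime : ∀ q : HeightOneSpectrum (𝓞 ℚ), Fact (Ideal.absNorm q.asIdeal).Prime :=
    fun q => ⟨FSComp.prime_absNorm_rat q⟩
  have hne : ∀ q : HeightOneSpectrum (𝓞 ℚ),
      NeZero ((Ideal.absNorm q.asIdeal : ℕ) : q.adicCompletion ℚ) := fun q => by
    haveI : CharZero (q.adicCompletion ℚ) :=
      charZero_of_injective_algebraMap (algebraMap ℚ (q.adicCompletion ℚ)).injective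
    exact ⟨Nat.cast_ne_zero.2 (FSComp.prime_absNorm_rat q).ne_zero⟩
  have hM' : ∀ q ∈ D.primes, ∀ m : geomTorsion W (p : ℤ), (Ideal.absNorm q.asIdeal - 1) • m = 0 :=
    fun q hq => absNorm_sub_one_smul_eq_zero_of_mem_frobeniusClassPrimes _ (hmono q hq) hτμp hM
  have hU : ∀ q ∈ D.primes,
      Nat.card (unramifiedSubgroup (GaloisRep.toLocal q (W.torsionGaloisModule (p : ℤ))) 1) = p :=
    fun q hq => natCard_unramifiedSubgroup_toLocal_of_mem_frobeniusClassPrimes _ (hmono q hq) hτ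
  have hT' : ∀ q ∈ D.primes, Nat.card (D.transverse (Sum.inr q)) = p := fun q hq => by
    haveI := hprime q; haveI := hne q
    rw [hT]
    exact natCard_cyclotomicTransverse_rat_of_mem_frobeniusClassPrimes' _ (hmono q hq) hτ (hM' q hq)
  have hUT : ∀ q ∈ D.primes, unramifiedSubgroup (GaloisRep.toLocal q (W.torsionGaloisModule (p : ℤ))) 1 ⊔
      D.transverse (Sum.inr q) = ⊤ := fun q hq => by
    haveI := hprime q; haveI := hne q
    rw [hT]
    exact unramifiedSubgroup_sup_cyclotomicTransverse_eq_top_of_mem_frobeniusClassPrimes _ (hmono q hq)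
      (hM' q hq) (modPCyclotomicCharacter_surjOn_absInertia_rat_holds q)
  -- the mixed pair: §1 on `x, θ'y, θ'y`, `θ'` the inverse Weil map
  have hSfin : {v : HeightOneSpectrum (𝓞 ℚ) | (Sum.inr v : Place ℚ) ∈ S}.Finite :=
    S.finite_toSet.preimage Sum.inr_injective.injOn
  have hC55 := PrimeChoice.hC55_deep_of_hasSurjectiveModNGaloisRep W p hp2 hsurj ρ' hker hN' _ hSfin hτ hH3
  have hθ' : Injective (galoisCohomology.map (weilDualInv W p e hμ hadd₁ hadd₂ hgal hnondeg) 1) := by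
    intro y y' h
    have h' := congrArg (galoisCohomology.map (weilDualIntertwining W p e hμ hadd₁ hadd₂ hgal) 1) h
    rwa [map_weilDual_map_weilDualInv, map_weilDual_map_weilDualInv] at h'
  refine apply_eq_zero_of_apply_empty_eq_zero hperf hsum hcompl hM hS h𝓕 h1 h0 hPS hadm hU hT' hUT
    (fun x hx y hy => ?_) hκ hκ₀ n
  have hy' : galoisCohomology.map (weilDualInv W p e hμ hadd₁ hadd₂ hgal hnondeg) 1 y ≠ 0 :=
    fun h => hy (hθ' (by rw [h, map_zero]))
  rw [hP]
  refine (hC55 x _ _ hx hy' hy').mono fun q hq => ⟨hq.1, hq.2.1, fun h0' => hq.2.2.1 ?_⟩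
  rw [localization_map_one_eq, h0']
  exact map_zero _

end CoreRankOne

/-! ### §3 The N11 reading on `(E[3], 𝓕̄_can)` with deep primes -/

variable (W : WeierstrassCurve ℚ) [W.IsElliptic]

/-- **Injectivity at the core vertex `∅` on `(E[3], 𝓕̄_can)` for a datum with DEEP primes
`frobeniusClassPrimes (E[3^{k′}·3]) {v | inr v ∈ S} τ 3^{k′+1}` — by base rigidity, NO [S24] binder, no tower**
(LITERALLY the `hinj` of END-m2 / END-m1 for such data): §2 at `p = 3` with (H.3) on the deep group
from `Irr W 3` (cc-typer-1's `hH3_three_pow_of_irr`; no tower), `𝓕̄_can` unramified outside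
`S ⊇ ∞ ∪ {3} ∪ {bad}`, `#H¹_{𝓕̄_can} = 3` from `H¹_{𝓕̄_can^*} = 0` and the core rank one (modulo `hEP`),
admissibility of THE canonical comparison maps on a sub-class
(`FSComp.isAdmissible_of_hasCanonicalComparison_of_subset`).
[cite: Rubin2011, Prop. 2.3.2 (1) and Cor. 2.8.9 (2) (pp. 19, 25)] [cite: Sakamoto2024, Cor. 5.5 (p. 929)] -/
theorem kolyvaginSystem_eq_zero_of_apply_empty_eq_zero_of_baseRigidity_deep
    [Finite (geomTorsion W ((3 : ℕ) : ℤ))]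
    (h3 : W.HasSurjectiveModNGaloisRep ((3 : ℕ) : ℤ)) (k' : ℕ)
    (τ : absoluteGaloisGroup ℚ) (hτμ : τ ∈ rootsOfUnityFixer ℚ (3 ^ (k' + 1)))
    (hτq : Nonempty (cokerSubOne (W.torsionGaloisModule ((3 : ℕ) : ℤ)) τ ≃+ ZMod 3))
    (inv : LocalInvariants ℚ 3) (hperf : inv.IsPerfect) (hsum : inv.SumLocalTermEqZero)
    (hcompl : inv.SelmerComplement)
    (hEP : ∀ v : HeightOneSpectrum (𝓞 ℚ), localEulerPoincareCharacteristic (v.adicCompletion ℚ))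
    (S : Finset (Place ℚ)) (hS : ∀ w : InfinitePlace ℚ, (Sum.inl w : Place ℚ) ∈ S)
    (h3S : ∀ v : HeightOneSpectrum (𝓞 ℚ), ((3 : ℕ) : 𝓞 ℚ) ∈ v.asIdeal → (Sum.inr v : Place ℚ) ∈ S)
    (hbadS : ∀ v : HeightOneSpectrum (𝓞 ℚ), ¬ W.HasGoodReductionAt v → (Sum.inr v : Place ℚ) ∈ S)
    (D : KolyvaginDatum (W.torsionGaloisModule ((3 : ℕ) : ℤ)))
    (η : (q : HeightOneSpectrum (𝓞 ℚ)) → (ZMod (Ideal.absNorm q.asIdeal))ˣ)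
    (hP : D.primes = frobeniusClassPrimes (W.torsionGaloisModule (((3 : ℕ) : ℤ) ^ k' * ((3 : ℕ) : ℤ)))
      {v | (Sum.inr v : Place ℚ) ∈ S} τ (3 ^ (k' + 1)))
    (hT : D.transverse = cyclotomicTransverse (W.torsionGaloisModule ((3 : ℕ) : ℤ)))
    (hD : D.HasCanonicalComparison 3 η) :
    ∀ κ : Finset (HeightOneSpectrum (𝓞 ℚ)) → galoisCohomology (W.torsionGaloisModule ((3 : ℕ) : ℤ)) 1,
      D.IsKolyvaginSystem (propagatedSelmerStructureOne W 3) κ →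
      (inv.dualSelmerStructure (W.torsionGaloisModule ((3 : ℕ) : ℤ))
        (D.atLevel (propagatedSelmerStructureOne W 3) ∅)).selmerGroup = ⊥ →
      κ ∅ = 0 → ∀ m, κ m = 0 := by
  intro κ hκ hcore hk0 m
  haveI : Fact (Nat.Prime 3) := ⟨Nat.prime_three⟩
  haveI : Finite (geomTorsion W (((3 : ℕ) : ℤ) ^ k' * ((3 : ℕ) : ℤ))) := finite_geomTorsion_pow_mul W 3 k'
  have hdvd : 3 ∣ 3 ^ (k' + 1) := dvd_pow_self 3 (Nat.succ_ne_zero k')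
  have hτμ3 : τ ∈ rootsOfUnityFixer ℚ 3 := rootsOfUnityFixer_le_of_dvd ℚ hdvd hτμ
  let T : Finset (HeightOneSpectrum (𝓞 ℚ)) := S.preimage Sum.inr Sum.inr_injective.injOn
  have h3T : ∀ v : HeightOneSpectrum (𝓞 ℚ), ((3 : ℕ) : 𝓞 ℚ) ∈ v.asIdeal → v ∈ T :=
    fun v hv => Finset.mem_preimage.mpr (h3S v hv)
  have hbadT : ∀ v : HeightOneSpectrum (𝓞 ℚ), ¬ W.HasGoodReductionAt v → v ∈ T :=
    fun v hv => Finset.mem_preimage.mpr (hbadS v hv)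
  have hempty : D.atLevel (propagatedSelmerStructureOne W 3) ∅ = propagatedSelmerStructureOne W 3 :=
    SelmerStructure.modify_empty _ D.transverse
  rw [hempty] at hcore
  have hχ := hasCoreRank_one_propagatedSelmerStructureOne_of_isPerfect_of_localEuler W inv hperf hsum
    hcompl hEP T h3T hbadT
  have h1 : Nat.card (propagatedSelmerStructureOne W 3).selmerGroup = 3 := by
    rw [LocalInvariants.HasCoreRank, pow_one, hcore, AddSubgroup.card_bot, mul_one] at hχ
    exact hχ
  have hker : ∀ u : absoluteGaloisGroup ℚ,
      W.torsionGaloisModule (((3 : ℕ) : ℤ) ^ k' * ((3 : ℕ) : ℤ)) u = 1 →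
        W.torsionGaloisModule ((3 : ℕ) : ℤ) u = 1 :=
    fun u hu => S24Deep.torsionGaloisModule_eq_one_of_dvd W (Dvd.intro_left _ rfl) u hu
  have hsub : D.primes ⊆ frobeniusClassPrimes (W.torsionGaloisModule ((3 : ℕ) : ℤ))
      {v | (Sum.inr v : Place ℚ) ∈ S} τ 3 := by
    rw [hP]
    exact S24Deep.frobeniusClassPrimes_mono _ _ hker _ τ hdvd
  have hadm : D.IsAdmissible :=
    FSComp.isAdmissible_of_hasCanonicalComparison_of_subset
      (W.torsionGaloisModule ((3 : ℕ) : ℤ)) 3 {v | (Sum.inr v : Place ℚ) ∈ S} hτq hτμ3 hsub hD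
  exact CoreRankOne.torsion_apply_eq_zero_of_apply_empty_eq_zero_rat_deep W 3 (by decide) h3
    (W.torsionGaloisModule (((3 : ℕ) : ℤ) ^ k' * ((3 : ℕ) : ℤ))) hker
    (pow_ne_zero _ three_ne_zero) hdvd hperf hsum hcompl
    (fun v hv => not_mem_and_isUnramifiedAt_three_of_not_mem W S h3S hbadS hv)
    (propagatedSelmerStructureOne_three_isUnramifiedOutside W S hS h3S hbadS) h1 hcore hP hT hτq hτμ
    (hH3_three_pow_of_irr W (hasIrreducibleModPGaloisRep_of_hasSurjectiveModNGaloisRep W 3 h3) k')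
    hadm hκ hk0 m

end Summit.BirchSwinnertonDyer.Rank1Residual.GaloisImage

end
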